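/-
Copyright: audit package `pub-balaban` (b2b), unit `b2b-balaban-pv09-g11` (SURGE NODE PROVER #09, gen 11).
Released under the licence of the host repository.
-/
import Mathlib
import Literature.MathematicalPhysics.QuantumFieldTheory.Balaban1983to89.B6Cov2156Subset166
import Literature.MathematicalPhysics.QuantumFieldTheory.Balaban1983to89.B6Jacobian2155Torus
import Literature.MathematicalPhysics.QuantumFieldTheory.Balaban1983to89.B5Hk163Form166
import Literature.MathematicalPhysics.QuantumFieldTheory.Balaban1983to89.B5RealFields

/-!
# Bałaban 1984 (Propagators II, CMP 96), (2.152)–(2.157) on the torus FOR THE GENUINE (1.65) OPERATOR Δ_k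
# (v1.1: + §5, Δ_k is real — the junction `deltaPol = Δ_k` holds entrywise in ℂ)

T. Bałaban, *Propagators and renormalization transformations for lattice gauge theories. II*,
Commun. Math. Phys. **96** (1984) 223–250 (= [Balaban1984PropagatorsII]), pp. 249–250 [PDF 27–28], formulas
(2.152)–(2.157); T. Bałaban, *Propagators and renormalization transformations for lattice gauge theories. I*,
Commun. Math. Phys. **95** (1984) 17–40 (= [Balaban1984PropagatorsI]), Section D p. 29 [PDF 13], formulas
(1.65)–(1.67).

## The audited sentences (verbatim, read from the page images this session)

[Balaban1984PropagatorsI] p. 29 [PDF 13] (render `…1984-cmp95-propagators-rt-I-p013-x2.png`): «The action Δ_k is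
thus defined by ⟨B, Δ_kB⟩ = ⟨∂H_kB, ∂H_kB⟩. (1.65) Using formulas (1.60) or (1.63) we obtain the following
expression ⟨B, Δ_kB⟩ = ½Σ_{μ,ν}⟨(∂¹_μB_ν − ∂¹_νB_μ), φ_μ⁻¹φ_ν⁻¹(∂₁*φ⁻¹∂₁)⁻¹(∂¹_μB_ν − ∂¹_νB_μ)⟩ = ⟨∂₁B, σ_k∂₁B⟩
= ½Σ_{μ,ν}(2π)^{−d}∫dp′ [1 / ((Σ_{λ=1}^{d} |∂¹_λ(p′)|²/(Δ₀²(p′)φ_λ(p′))) Δ₀(p′)φ_μ(p′)Δ₀(p′)φ_ν(p′))]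
|(∂₁B)~_{μν}(p′)|². (1.66) The function under the integral is bounded from below and above by positive constants
γ₀, γ₁ dependent on d only, so we have γ₀⟨∂₁B, ∂₁B⟩ ≦ ⟨B, Δ_kB⟩ ≦ γ₁⟨∂₁B, ∂₁B⟩. (1.67)».

[Balaban1984PropagatorsII] p. 249 [PDF 27] (render `…1984-cmp96-propagators-rt-II-p027-x2.png`): «Next let us
consider the inequality (2.128) in Lemma 2.4 again. We will apply it in the following situation. Doing a k + 1
renormalization transformation we have to calculate an integral of the form const ∫dBδ(QB)δ_{Ax}(B)
e^{−½⟨B, Δ_kB⟩}F(B) (1.152) [sic] on the whole lattice T^{(k)}, or on a subset Λ ⊂ T^{(k)}. Using (2.118) and (2.128) we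
get ⟨B, Δ_kB⟩ ≧ (γ₀/12d²)L^{−d−1}‖B‖², or Δ_k ≧ (γ₀/12d²)L^{−d−1} (2.153) on the subspace of B satisfying: QB = 0,
B(Γ_{y,x}) = 0 for x ∈ B(y). Let us denote the covariance of the Gaussian integration in (2.152) by C^{(k)}, or by
C^{(k)}_Λ, hence ∫dB↾_Λ δ(QB)δ_{Ax}(B)e^{−½⟨B, Δ_kB⟩+⟨J,B⟩} = Z^{(k)}e^{½⟨J, C^{(k)}_Λ J⟩}. (2.154)»;
p. 250 [PDF 28] (render `…-p028-x2.png`): «C^{(k)}_Λ = C(C*Δ_kC)⁻¹C*. (2.156) … The inequality (2.153) implies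
⟨B′, C*Δ_kCB′⟩ ≧ (γ₀/12d²)L^{−d−1}‖CB′‖² ≧ γ′₀‖B′‖², (2.157) where γ′₀ = (γ₀/12d²)L^{−d−1}. C is a short-ranged
operator, so C*Δ_kC has the same exponential decay as Δ_k. Now we may apply the theory developed in Sect. 5 of [3]
on unit lattice operators. It gives us an exponential decay, and all the other properties, for the operator
(C*Δ_kC)⁻¹, hence for C^{(k)}_Λ also.»

## What this module certifies — ONE JUNCTION of three lineages (torus model; every d, every torus, every n ≥ 1)

Upstream, the pv09 torus line certified the closing paragraph (2.152)–(2.157) of [Balaban1984PropagatorsII] END TO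
END, with NO residual hypothesis, for `B6Cov2156Torus.deltaPol M n` — THE symmetric matrix of the (1.66)-DEFINED form
`B5Bounds167Lattice.formDk n M` in the bond basis of the torus (`B6Cov2156Torus` v1.1, `B6Cov2156TorusSubset`,
`B6Jacobian2155Torus`, `B5Kernel166Decay.kernelDecay166` / `cov2156_torus_166`, `B6Cov2156Subset166`), recording as
NOT certified «the identity of the (1.66) form with (1.65) ⟨∂H_kB, ∂H_kB⟩» (`B6Cov2156Torus` HONEST SCOPE (ii),
`B6LowerBound2153Torus` HONEST SCOPE (i)).  Meanwhile the β sub-cell typed THE GENUINE OPERATOR OF (1.65),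
`Beta.BlockEffectiveAction.DelK n hn M a ha := n^{-d}·H_kᴴ(½(CurlOp)ᴴCurlOp)H_k` (= (QGQ*)⁻¹ − a, `DelK_eq`; Hermitian,
`a`-free), with (1.67) for it (`Beta.Ineq167OperatorUpper.ineq167_DelK`, γ₀ = 1, γ₁ = (π²/4)^{d+2}), and b05-g12
proved the (1.65)↔(1.66) dictionary AT FORM LEVEL: `B5Hk163Form166.DelK_form_eq_formDk : Bᴴ·Δ_k·B = formDk n M B`.

PROVED HERE (zero `sorry`; finite-dimensional bookkeeping over kernel theorems of the package — [folklore]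
junctions; NO printed statement enters as a hypothesis, ABSOLUTE RULE):
* §1 `idxEquiv M : B4.Idx (pbox M) d ≃ Tor M × Fin d` — the variables of the box ARE the bonds of the torus
  ((x, ν) ↦ (x mod M, ν); `B6Cov2156Torus.ofBox` is the pull-back along its inverse, `ofBox_apply`).
* §2 `reDelK n hn M := Re Δ_k` read in the bond basis of the box, `reDelK_isSymm` (← `DelK_conjTranspose`),
  `quad_reDelK : ⟨B, (Re Δ_k)B⟩ = Re(B̃ᴴ·Δ_k·B̃)` and `quad_reDelK_complex : (⟨B, (Re Δ_k)B⟩ : ℂ) = B̃ᴴ·Δ_k·B̃` for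
  every REAL field B on the torus bonds (B̃ = B read in ℂ; the quadratic form of (2.152) is real and sees exactly
  Re Δ_k), `represents_reDelK : Represents M n (reDelK n hn M)` (← `DelK_form_re_eq_formDk`), and THE JUNCTION
  **`deltaPol_eq_reDelK : deltaPol M n = reDelK n hn M`** (← `B6Cov2156Torus.eq_deltaPol_of_represents`), entrywise
  **`deltaPol_apply_eq : deltaPol M n (b, b′) = Re Δ_k(b, b′)`** for every dummy `a > 0` — the matrix about which the
  whole pv09 torus line speaks IS (the real part of) the genuine (1.65) operator of the β cell.
* §3 consequences BY REWRITING, for the genuine Δ_k: `re_DelK_decay` — ∃ c₀, δ₀ > 0 (d only) with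
  |Re Δ_k(b, b′)| ≤ c₀e^{−δ₀ρ_M(b₋, b′₋)} on every torus, every n ≥ 1 (← `kernelDecay166`: «the same exponential
  decay as Δ_k» is a THEOREM for the typed Δ_k); **`cov2156_torus_DelK`, `cov2156_torusS_DelK`,
  `cov2156_torus_subset_DelK`** — the decay |C^{(k)}_Λ(b, b′)| ≤ c·e^{−δρ_M(b₋,b′₋)} of C(C*(Re Δ_k)C)⁻¹C* (2.156) on
  the whole torus, for every sub-family of the remaining variables, and for every Λ = B(Λ′₀) ⊂ T^{(k)}
  (← `cov2156_torus_166`, `cov2156_torusS_166`, `cov2156_torus_subset_166`); `lowerOnConstrainedT_reDelK` —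
  (2.153)_T with γ′₀ = `gamma2153 d L` (γ₀ = (4/π²)^{d+2}); `sandwich_posDef_reDelK` (C*(Re Δ_k)C > 0),
  `Zred_reDelK`, `eq_2155_reDelK` ((2.155) evaluated) (← `B6Jacobian2155Torus`).
* §4 (2.153) and (2.157) WITH THE β CELL'S SHARPER γ₀ = 1 for the genuine operator: `lowerBound2153_lattice_sharp`
  ((2.128) on T, `B6Lemma24Torus.lemma24_torus`, + `B5Hk163Form166.ineq167_formDk_sharp`), `constraints_ofBox`
  (the box constraints «QB = 0, B(Γ_{y,x}) = 0» ARE the torus constraints of the field read on `Tor M × Fin d`),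
  `lowerOnConstrainedT_sharp_of_represents`, **`lowerOnConstrainedT_reDelK_sharp`**:
  ⟨B, (Re Δ_k)B⟩ ≥ (1/12d²)L^{−d−1}‖B‖² on {QB = 0, B(Γ_{y,x}) = 0} (`gamma2153one d L` ≥ `gamma2153 d L`,
  `gamma2153_le_gamma2153one`; `lowerOnConstrainedT_mono`), **`ineq_2157_reDelK_sharp`** (both inequalities of
  (2.157) with γ′₀ = (1/12d²)L^{−d−1}), and the typed node **`lowerBound2153_tor_DelK :
  B6.LowerBound2153 d L 1 (torCarrier) (⟨B, Δ_kB⟩ of (1.65)) QZero`** via `B6.lowerBound2153_of_lemma24` +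
  `B6LowerBound2153Torus.lemma24Printed_tor` + `ineq167_DelK` (h2118 with γ₀ = 1), with its two printed readings of
  «QB = 0» (`…_faces`: (Q₁B)(c) = 0 at every coarse bond, Q₁ verbatim from (2.125)).

* §5 (v1.1) **Δ_k IS REAL**: `isReal_DelK : B5RealFields.IsReal (DelK n hn M a ha)` — Δ_k = (QGQ*)⁻¹ − a
  (`DelK_eq`) with Q, Q*, G = Δ_a⁻¹ real (pv15's `B5RealFields.isReal_QvOp` ∕ `isReal_QvAdj` ∕ `isReal_DeltaA_inv`,
  `B5DeltaA169.calG_eq_DeltaA_inv`); hence `im_DelK_eq_zero`, `DelK_eq_ofReal_re`, `DelK_transpose` (real Hermitian ⇒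
  symmetric), `reDelK_map_ofReal`, and THE FULL JUNCTION **`deltaPol_eq_DelK : (deltaPol M n (b, b′) : ℂ) = Δ_k(b, b′)`**
  ∕ **`DelK_eq_reindex_deltaPol : Δ_k = (deltaPol M n, re-indexed by idxEquiv, read in ℂ)`** — THE matrix of the
  (1.66) form IS the genuine (1.65) operator, entrywise, as complex numbers (v1's proviso «modulo Im Δ_k» is gone).

HONEST SCOPE.  (i) Torus model throughout, as in the whole lineage and in the β cell (fine torus `Π ℤ/(nM_μ)` over
the unit torus `Tor M = Π ℤ/M_μ`, U = 1, m² = 0; `n = L^k ≥ 1` a free parameter); nothing on the infinite lattice,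
nothing about an independently defined restricted operator Δ_{k,Λ} (Λ enters only through the elimination
operator C_Λ, `B6Cov2156TorusSubset`).  (ii) REAL PART ∕ REALITY: the operator transported is `Re Δ_k` (entrywise real
part of the Hermitian `DelK`, so that it is a real matrix on the variables of the box); for the REAL fields B of
(2.152)–(2.157) the quadratic form ⟨B, Δ_kB⟩ is real and equals ⟨B, (Re Δ_k)B⟩ exactly (`quad_reDelK_complex`);
since v1.1 `Im Δ_k = 0` IS PROVED (§5 `isReal_DelK`, from pv15's `B5RealFields`), so `Re Δ_k` loses nothing:
`deltaPol M n = Δ_k` entrywise as complex numbers (`deltaPol_eq_DelK`, `DelK_eq_reindex_deltaPol`).  (iii) Constants: γ₀ = 1 / (4/π²)^{d+2}, (c₀, δ₀), (c, δ) are the package's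
(existential where printed as O(1)); Bałaban's own unprinted γ₀, γ₁ are not reconstructed.  (iv) NOT claimed: the
Gaussian integral (1.64), «all the other properties» of Sect. 5 of [3] beyond the kernel decay, anything about β,
Proposition 1.2, the continuum limit.  Value = a junction certificate closing `B6Cov2156Torus` HONEST SCOPE (ii) and
`B6LowerBound2153Torus` HONEST SCOPE (i) BY NAME for the typed (1.65) operator (in full since v1.1); NOT summit
progress; NOT the continuum limit; NOT Clay.

Imported BY NAME, none edited: `…B6Cov2156Subset166` (pv09-g6; hence `B5Kernel166Decay` (b05-g9), `B6Cov2156Torus`,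
`B6Cov2156TorusSubset`, `B6LowerBound2153Torus`, `B6Lemma24Torus`), `…B6Jacobian2155Torus` (pv09-g6),
`…B5Hk163Form166` (b05-g12; hence `Beta.BlockEffectiveAction`, `Beta.Ineq167Operator(Upper)`, `B5Bounds167Lattice`),
and since v1.1 `…B5RealFields` (pv15-g3; `IsReal`, reality of Q, Q*, Δ_a⁻¹).
Unit `b2b-balaban-pv09-g11` (SURGE NODE PROVER #09, gen 11), node G-B6-2156-DELK-TORUS (GAPS C-pv09g11-1: v1 p190927
commit 52ea331d602a = §1–§4; v1.1 = v1 + §5 APPEND-ONLY, every v1 declaration unchanged, one import added); staged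
byte-identically under `HOME/lean/BalabanYm4/`.
-/

noncomputable section

open scoped BigOperators Matrix ComplexConjugate
open Finset Matrix

namespace Literature.MathematicalPhysics.QuantumFieldTheory.Balaban1983to89.B6Cov2156TorusDelK

open B6BondElimination (IsTree treeBonds mem_treeBonds isTree_iff)
open B6Lemma24PrintedShape (q1)
open B6Lemma24Torus (IsPeriodic pbox mem_pbox coarseSites faces wrap wrap_mem_pbox wrap_eq_self block_subset_pbox
  coarseSites_dvd q1SqT d1SqT normSqT lemma24_torus)
open B6BondEliminationTorus (pdist)
open B6LowerBound2153Torus (toT rep rep_mem_pbox rep_toT toT_rep lift lift_apply isPeriodic_lift pos_of_neZero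
  d1SqT_lift normSqT_lift torCarrier lemma24Printed_tor)
open B6Cov2156Torus (one_le_M perExt ofBox lift_ofBox perExt_coe sum_box_eq freeT elimT elimT_iso
  LowerOnConstrainedT Represents gamma2153 gamma2153_pos lowerOnConstrainedT_of_represents bondReductionT deltaPol
  deltaPol_isSymm represents_deltaPol eq_deltaPol_of_represents KernelDecay quad_eq_sum_sum)
open B6Cov2156TorusSubset (subFamilyT bondReductionLam lamFree lamFree_subset elimLam)
open B6Cov2156Subset166 (cov2156_torusS_166 cov2156_torus_subset_166)
open B6Jacobian2155Torus (sandwich_posDef redInt Zred Zred_eq eq_2155_eval ineq_2157_mid)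
open B5Kernel166Decay (kernelDecay166 cov2156_torus_166)
open B5Prop11Plancherel (Tor)
open B5Bounds167Lattice (ofRealCfg formDk d1Sq)
open Beta.BlockEffectiveAction (DelK DelK_eq DelK_conjTranspose DelK_indep)
open Beta.FluctuationProjection (QGQ)
open B5DeltaA169 (calG_eq_DeltaA_inv)
open B5RealFields (IsReal isReal_QvOp isReal_QvAdj isReal_DeltaA_inv)
open Beta.Ineq167Operator (formOfDelK)
open Beta.Ineq167OperatorUpper (gamma1 ineq167_DelK)
open B5Hk163Form166 (DelK_form_eq_formDk DelK_form_re_eq_formDk ineq167_formDk_sharp)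
open B6 (LowerBound2153 lowerBound2153_of_lemma24)

variable {d : ℕ}

/-! ## §1  The variables of the box ≃ the bonds of the torus -/

section Index

variable (M : Fin d → ℕ) [∀ μ, NeZero (M μ)]

/-- THE INDEX DICTIONARY: the variables of the box (the bonds of the torus, once each, `B4.Idx (pbox M) d`) ≃ the
bonds `Tor M × Fin d` of the torus: (x, ν) ↦ (x mod M, ν), inverse t ↦ its box representative
(`B6Cov2156Torus.boxEquiv` on the first factor). [folklore] -/
def idxEquiv : B4.Idx (pbox M) d ≃ Tor M × Fin d where
  toFun p := (toT M (p.1 : Fin d → ℤ), p.2)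
  invFun s := (⟨rep M s.1, rep_mem_pbox M s.1⟩, s.2)
  left_inv p := Prod.ext (Subtype.ext (rep_toT M p.1.2)) rfl
  right_inv s := Prod.ext (toT_rep M s.1) rfl

/-- Evaluation. [folklore] -/
theorem idxEquiv_apply (p : B4.Idx (pbox M) d) : idxEquiv M p = (toT M (p.1 : Fin d → ℤ), p.2) := rfl

/-- Evaluation of the inverse. [folklore] -/
theorem idxEquiv_symm_apply (s : Tor M × Fin d) :
    (idxEquiv M).symm s = (⟨rep M s.1, rep_mem_pbox M s.1⟩, s.2) := rfl

/-- `B6Cov2156Torus.ofBox` (a box field read on `Tor M × Fin d`) IS the pull-back along `idxEquiv⁻¹`. [folklore] -/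
theorem ofBox_apply (B : B4.Idx (pbox M) d → ℝ) (s : Tor M × Fin d) : ofBox M B s = B ((idxEquiv M).symm s) := rfl

/-- … so on the image of a variable it is the field itself. [folklore] -/
theorem ofBox_idxEquiv (B : B4.Idx (pbox M) d → ℝ) (p : B4.Idx (pbox M) d) : ofBox M B (idxEquiv M p) = B p := by
  rw [ofBox_apply, Equiv.symm_apply_apply]

omit [∀ μ, NeZero (M μ)] in
/-- A real field read in ℂ is fixed by `star`. [folklore] -/
theorem star_ofRealCfg (X : Tor M × Fin d → ℝ) : star (ofRealCfg M X) = ofRealCfg M X := by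
  funext s
  simp [ofRealCfg, Pi.star_apply]

end Index

/-! ## §2  `Re Δ_k` in the bond basis; it represents the (1.66) form; it IS `deltaPol` -/

section ReDelK

variable (n : ℕ) (hn : 1 ≤ n) (M : Fin d → ℕ) [∀ μ, NeZero (M μ)]

/-- **`Re Δ_k` IN THE BOND BASIS OF THE TORUS**: the real part of the kernel of THE GENUINE (1.65) OPERATOR
`Beta.BlockEffectiveAction.DelK` (= n^{-d}H_kᴴ(∂*∂)H_k = (QGQ*)⁻¹ − a), indexed by the variables of the box; the
dummy `a` of `DelK` is fixed to 1 (`DelK_indep`: Δ_k is a-free, `reDelK_apply`).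
[cite: Balaban1984PropagatorsI, (1.65) p.29; Balaban1984PropagatorsII, (2.152)–(2.153) p.249 (the Δ_k there)] -/
def reDelK : Matrix (B4.Idx (pbox M) d) (B4.Idx (pbox M) d) ℝ :=
  haveI : NeZero n := ⟨by omega⟩
  fun p q => (DelK n hn M 1 one_pos (idxEquiv M p) (idxEquiv M q)).re

/-- **⟨B, Δ_kB⟩ OF (1.65) FOR A REAL FIELD ON THE TORUS BONDS** (the fields of (2.152)–(2.157) are real):
Re(B̃ᴴ·Δ_k·B̃), B̃ = B read in ℂ. [cite: Balaban1984PropagatorsI, (1.65) p.29] -/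
def formDelK (B : Tor M × Fin d → ℝ) : ℝ :=
  haveI : NeZero n := ⟨by omega⟩
  (star (ofRealCfg M B) ⬝ᵥ (DelK n hn M 1 one_pos *ᵥ ofRealCfg M B)).re

end ReDelK

section Dictionary

variable (n : ℕ) [NeZero n] (hn : 1 ≤ n) (M : Fin d → ℕ) [∀ μ, NeZero (M μ)] (a : ℝ) (ha : 0 < a)

/-- `Re Δ_k(b, b′)` for any dummy `a > 0`. [folklore] -/
theorem reDelK_apply (p q : B4.Idx (pbox M) d) :
    reDelK n hn M p q = (DelK n hn M a ha (idxEquiv M p) (idxEquiv M q)).re := by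
  unfold reDelK
  rw [← DelK_indep n hn M 1 one_pos a ha]

/-- `formDelK` for any dummy `a > 0`. [folklore] -/
theorem formDelK_eq (B : Tor M × Fin d → ℝ) :
    formDelK n hn M B = (star (ofRealCfg M B) ⬝ᵥ (DelK n hn M a ha *ᵥ ofRealCfg M B)).re := by
  unfold formDelK
  rw [← DelK_indep n hn M 1 one_pos a ha]

/-- `formDelK` IS the β cell's carrier form `(formOfDelK n hn M a ha).formΔk` on real fields. [folklore] -/
theorem formDelK_eq_formOfDelK (B : Tor M × Fin d → ℝ) :
    formDelK n hn M B = (formOfDelK n hn M a ha).formΔk (ofRealCfg M B) := by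
  rw [formDelK_eq n hn M a ha]
  rfl

/-- KERNEL-CHECKED: **⟨B, (Re Δ_k)B⟩ = Re(B̃ᴴ·Δ_k·B̃)** for every real field B on the variables of the box (B̃ = the
same field on `Tor M × Fin d`, read in ℂ) — the quadratic form of (2.152) in the bond basis. [folklore] -/
theorem quad_reDelK (B : B4.Idx (pbox M) d → ℝ) :
    ∑ p, B p * (reDelK n hn M *ᵥ B) p
      = (star (ofRealCfg M (ofBox M B)) ⬝ᵥ (DelK n hn M a ha *ᵥ ofRealCfg M (ofBox M B))).re := by
  rw [quad_eq_sum_sum]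
  have hR : (star (ofRealCfg M (ofBox M B)) ⬝ᵥ (DelK n hn M a ha *ᵥ ofRealCfg M (ofBox M B))).re
      = ∑ s, ∑ s', ofBox M B s * ofBox M B s' * (DelK n hn M a ha s s').re := by
    rw [star_ofRealCfg]
    simp only [dotProduct, Matrix.mulVec, ofRealCfg, Finset.mul_sum, Complex.re_sum, Complex.re_ofReal_mul,
      Complex.re_mul_ofReal]
    refine Finset.sum_congr rfl fun s _ => Finset.sum_congr rfl fun s' _ => ?_
    ring
  rw [hR]
  refine Fintype.sum_equiv (idxEquiv M) _ _ fun p => ?_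
  refine Fintype.sum_equiv (idxEquiv M) _ _ fun q => ?_
  rw [ofBox_idxEquiv, ofBox_idxEquiv, reDelK_apply n hn M a ha]

/-- KERNEL-CHECKED: for REAL B the complex number B̃ᴴ·Δ_k·B̃ IS the real quadratic form ⟨B, (Re Δ_k)B⟩ — the
exponent −½⟨B, Δ_kB⟩ of (2.152) is real and sees exactly `Re Δ_k`. [folklore] -/
theorem quad_reDelK_complex (B : B4.Idx (pbox M) d → ℝ) :
    ((∑ p, B p * (reDelK n hn M *ᵥ B) p : ℝ) : ℂ)
      = star (ofRealCfg M (ofBox M B)) ⬝ᵥ (DelK n hn M a ha *ᵥ ofRealCfg M (ofBox M B)) := by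
  rw [quad_reDelK n hn M a ha, DelK_form_eq_formDk n hn M a ha, Complex.ofReal_re]

end Dictionary

section Junction

variable (n : ℕ) (hn : 1 ≤ n) (M : Fin d → ℕ) [∀ μ, NeZero (M μ)]

/-- The (1.65)↔(1.66) dictionary on real fields: `formDelK n hn M B = formDk n M B̃` (b05-g12's
`DelK_form_re_eq_formDk`). [cite: Balaban1984PropagatorsI, (1.65)–(1.66) p.29] -/
theorem formDelK_eq_formDk (B : Tor M × Fin d → ℝ) : formDelK n hn M B = formDk n M (ofRealCfg M B) := by
  haveI : NeZero n := ⟨by omega⟩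
  rw [formDelK_eq n hn M 1 one_pos]
  exact DelK_form_re_eq_formDk n hn M 1 one_pos _

/-- KERNEL-CHECKED: `Re Δ_k` is symmetric (Δ_k is Hermitian, `DelK_conjTranspose`). [folklore] -/
theorem reDelK_isSymm : (reDelK n hn M).IsSymm := by
  haveI : NeZero n := ⟨by omega⟩
  refine Matrix.IsSymm.ext fun p q => ?_
  have hH : (DelK n hn M 1 one_pos).IsHermitian := DelK_conjTranspose n hn M 1 one_pos
  have h := congrArg Complex.re (hH.apply (idxEquiv M p) (idxEquiv M q))
  rw [Complex.star_def, Complex.conj_re] at h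
  rw [reDelK_apply n hn M 1 one_pos, reDelK_apply n hn M 1 one_pos]
  exact h

/-- ⟨B, (Re Δ_k)B⟩ = `formDelK` of the field read on the torus. [folklore] -/
theorem quad_reDelK_eq_formDelK (B : B4.Idx (pbox M) d → ℝ) :
    ∑ p, B p * (reDelK n hn M *ᵥ B) p = formDelK n hn M (ofBox M B) := by
  haveI : NeZero n := ⟨by omega⟩
  rw [quad_reDelK n hn M 1 one_pos, formDelK_eq n hn M 1 one_pos]

/-- KERNEL-CHECKED: **`Re Δ_k` REPRESENTS THE (1.66) FORM** (`B6Cov2156Torus.Represents`): ⟨B, (Re Δ_k)B⟩ =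
`formDk n M B̃` for every real B — the (1.65)↔(1.66) dictionary of b05-g12 in the bond basis.
[cite: Balaban1984PropagatorsI, (1.65)–(1.66) p.29] -/
theorem represents_reDelK : Represents M n (reDelK n hn M) := fun B => by
  rw [quad_reDelK_eq_formDelK n hn M, formDelK_eq_formDk n hn M]

/-- **THE JUNCTION: `deltaPol M n = reDelK n hn M`** — THE matrix of the (1.66) form (about which `B6Cov2156Torus`,
`B6Cov2156TorusSubset`, `B6Jacobian2155Torus`, `B5Kernel166Decay`, `B6Cov2156Subset166`, `T4Cov2156Rate` speak) IS
`Re Δ_k` of the genuine (1.65) operator in the bond basis (polarization matrix `B6Cov2156Torus.deltaPol` = the unique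
symmetric representative, `eq_deltaPol_of_represents`): `B6Cov2156Torus` HONEST SCOPE (ii) («what stays NOT
certified, package-wide, is the identity of the (1.66) form with (1.65) ⟨∂H_kB, ∂H_kB⟩») and `B6LowerBound2153Torus`
HONEST SCOPE (i) are CLOSED BY NAME (`Im Δ_k = 0`: §5 `isReal_DelK`, `deltaPol_eq_DelK`, since v1.1).
[cite: Balaban1984PropagatorsI, (1.65)–(1.66) p.29] -/
theorem deltaPol_eq_reDelK : deltaPol M n = reDelK n hn M :=
  (eq_deltaPol_of_represents M n (reDelK_isSymm n hn M) (represents_reDelK n hn M)).symm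

end Junction

section Entrywise

variable (n : ℕ) [NeZero n] (hn : 1 ≤ n) (M : Fin d → ℕ) [∀ μ, NeZero (M μ)] (a : ℝ) (ha : 0 < a)

/-- **THE JUNCTION, ENTRYWISE: `deltaPol M n (b, b′) = Re Δ_k(b, b′)`** for every dummy `a > 0`.
[cite: Balaban1984PropagatorsI, (1.65)–(1.66) p.29] -/
theorem deltaPol_apply_eq (p q : B4.Idx (pbox M) d) :
    deltaPol M n p q = (DelK n hn M a ha (idxEquiv M p) (idxEquiv M q)).re := by
  rw [deltaPol_eq_reDelK n hn M, reDelK_apply n hn M a ha]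

/-- The same read from the torus side: `Re Δ_k(s, s′) = deltaPol M n (rep s, rep s′)`. [folklore] -/
theorem re_DelK_apply_eq (s s' : Tor M × Fin d) :
    (DelK n hn M a ha s s').re = deltaPol M n ((idxEquiv M).symm s) ((idxEquiv M).symm s') := by
  rw [deltaPol_apply_eq n hn M a ha, Equiv.apply_symm_apply, Equiv.apply_symm_apply]

end Entrywise

/-! ## §3  Consequences by rewriting: the B6 closing paragraph for the genuine Δ_k -/

section Consequences

variable {L : ℕ}

/-- **THE KERNEL OF THE GENUINE Δ_k DECAYS** (box indexing): ∃ c₀, δ₀ > 0 (d only) with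
|Re Δ_k(b, b′)| ≤ c₀e^{−δ₀ρ_M(b₋, b′₋)} on every torus, every n ≥ 1 — `B5Kernel166Decay.kernelDecay166` through the
junction; p. 250's presupposition «the same exponential decay as Δ_k» for the typed operator.
[cite: Balaban1984PropagatorsII, p.250] -/
theorem kernelDecay_reDelK (hd : 1 ≤ d) : ∃ c₀ δ₀ : ℝ, 0 < c₀ ∧ 0 < δ₀ ∧
    ∀ (M : Fin d → ℕ) [∀ μ, NeZero (M μ)] (n : ℕ) (hn : 1 ≤ n) (p q : B4.Idx (pbox M) d),
      |reDelK n hn M p q| ≤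
        c₀ * Real.exp (-(δ₀ * pdist M (one_le_M M) (p.1 : Fin d → ℤ) (q.1 : Fin d → ℤ))) := by
  obtain ⟨c₀, δ₀, hc, hδ, hK⟩ := kernelDecay166 (d := d) hd
  refine ⟨c₀, δ₀, hc, hδ, fun M _ n hn p q => ?_⟩
  rw [← deltaPol_eq_reDelK n hn M]
  exact hK M n hn p q

/-- The same in the torus indexing of the β cell: |Re Δ_k(s, s′)| ≤ c₀e^{−δ₀ρ_M(rep s₋, rep s′₋)} for every dummy a.
[cite: Balaban1984PropagatorsII, p.250] -/
theorem re_DelK_decay (hd : 1 ≤ d) : ∃ c₀ δ₀ : ℝ, 0 < c₀ ∧ 0 < δ₀ ∧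
    ∀ (M : Fin d → ℕ) [∀ μ, NeZero (M μ)] (n : ℕ) [NeZero n] (hn : 1 ≤ n) (a : ℝ) (ha : 0 < a)
      (s s' : Tor M × Fin d),
      |(DelK n hn M a ha s s').re| ≤
        c₀ * Real.exp (-(δ₀ * pdist M (one_le_M M) (rep M s.1) (rep M s'.1))) := by
  obtain ⟨c₀, δ₀, hc, hδ, hK⟩ := kernelDecay_reDelK (d := d) hd
  refine ⟨c₀, δ₀, hc, hδ, fun M _ n _ hn a ha s s' => ?_⟩
  have h := hK M n hn ((idxEquiv M).symm s) ((idxEquiv M).symm s')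
  rw [reDelK_apply n hn M a ha, Equiv.apply_symm_apply, Equiv.apply_symm_apply] at h
  exact h

variable (d) in
/-- **KERNEL-CHECKED — B6 (2.152)–(2.157) END TO END ON THE WHOLE TORUS T^{(k)} FOR THE GENUINE (1.65) OPERATOR, NO
RESIDUAL HYPOTHESIS**: d ≥ 2, L ≥ 1 ⟹ ∃ c, δ > 0 (d, L only) such that for every torus (L ∣ M_i) and every level
n ≥ 1 the covariance C^{(k)} = C(C*Δ_kC)⁻¹C* of (2.156) (C = the explicit elimination operator of p. 250, `elimT`;
Δ_k = `Re Δ_k` of (1.65) in the bond basis) satisfies |C^{(k)}(b, b′)| ≤ c·e^{−δρ_M(b₋, b′₋)}.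
(`B5Kernel166Decay.cov2156_torus_166` through `deltaPol_eq_reDelK`.)
[cite: Balaban1984PropagatorsII, (2.152)–(2.157) pp.249–250; Balaban1984PropagatorsI, (1.65) p.29] -/
theorem cov2156_torus_DelK (hd : 2 ≤ d) (hL : 1 ≤ L) :
    ∃ c δ : ℝ, 0 < c ∧ 0 < δ ∧
      ∀ (M : Fin d → ℕ) [∀ μ, NeZero (M μ)], (∀ i, L ∣ M i) → ∀ (n : ℕ) (hn : 1 ≤ n),
        ∀ p q : B4.Idx (pbox M) d, |(bondReductionT L M (reDelK n hn M)).cov p q| ≤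
          c * Real.exp (-(δ * pdist M (one_le_M M) (p.1 : Fin d → ℤ) (q.1 : Fin d → ℤ))) := by
  obtain ⟨c, δ, hc, hδ, H⟩ := cov2156_torus_166 (d := d) hd hL
  refine ⟨c, δ, hc, hδ, fun M _ hLM n hn p q => ?_⟩
  rw [← deltaPol_eq_reDelK n hn M]
  exact H M hLM n hn p q

variable (d) in
/-- **KERNEL-CHECKED — (2.156)'s decay for EVERY SUB-FAMILY C_S of the torus scheme, genuine Δ_k, NO residual
hypothesis** (`B6Cov2156Subset166.cov2156_torusS_166` through the junction).
[cite: Balaban1984PropagatorsII, (2.152)–(2.157) pp.249–250; Balaban1984PropagatorsI, (1.65) p.29] -/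
theorem cov2156_torusS_DelK (hd : 2 ≤ d) (hL : 1 ≤ L) :
    ∃ c δ : ℝ, 0 < c ∧ 0 < δ ∧
      ∀ (M : Fin d → ℕ) [∀ μ, NeZero (M μ)], (∀ i, L ∣ M i) → ∀ (n : ℕ) (hn : 1 ≤ n),
        ∀ (S : Finset (B4.Idx (pbox M) d)) (hS : S ⊆ freeT L M),
        ∀ p q : B4.Idx (pbox M) d, |(subFamilyT L M S hS (reDelK n hn M)).cov p q| ≤
          c * Real.exp (-(δ * pdist M (one_le_M M) (p.1 : Fin d → ℤ) (q.1 : Fin d → ℤ))) := by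
  obtain ⟨c, δ, hc, hδ, H⟩ := cov2156_torusS_166 d hd hL
  refine ⟨c, δ, hc, hδ, fun M _ hLM n hn S hS p q => ?_⟩
  rw [← deltaPol_eq_reDelK n hn M]
  exact H M hLM n hn S hS p q

variable (d) in
/-- **KERNEL-CHECKED — THE DECAY OF C^{(k)}_Λ (2.156) ON EVERY Λ = B(Λ′₀) ⊂ T^{(k)} FOR THE GENUINE Δ_k, NO RESIDUAL
HYPOTHESIS** («It gives us an exponential decay … for the operator (C*Δ_kC)⁻¹, hence for C^{(k)}_Λ also.»):
∃ c, δ > 0 (d, L only) with |C_Λ(C_Λ*Δ_kC_Λ)⁻¹C_Λ*(b, b′)| ≤ c·e^{−δρ_M(b₋, b′₋)} for every torus (L ∣ M_i), every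
n ≥ 1, every Λ′₀ (`B6Cov2156Subset166.cov2156_torus_subset_166` through the junction).
[cite: Balaban1984PropagatorsII, (2.152)–(2.157) pp.249–250; Balaban1984PropagatorsI, (1.65) p.29] -/
theorem cov2156_torus_subset_DelK (hd : 2 ≤ d) (hL : 1 ≤ L) :
    ∃ c δ : ℝ, 0 < c ∧ 0 < δ ∧
      ∀ (M : Fin d → ℕ) [∀ μ, NeZero (M μ)], (∀ i, L ∣ M i) → ∀ (n : ℕ) (hn : 1 ≤ n),
        ∀ (Λ'₀ : Finset (Fin d → ℤ)) (p q : B4.Idx (pbox M) d),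
          |(bondReductionLam L M Λ'₀ (reDelK n hn M)).cov p q| ≤
            c * Real.exp (-(δ * pdist M (one_le_M M) (p.1 : Fin d → ℤ) (q.1 : Fin d → ℤ))) := by
  obtain ⟨c, δ, hc, hδ, H⟩ := cov2156_torus_subset_166 d hd hL
  refine ⟨c, δ, hc, hδ, fun M _ hLM n hn Λ'₀ p q => ?_⟩
  rw [← deltaPol_eq_reDelK n hn M]
  exact H M hLM n hn Λ'₀ p q

variable {M : Fin d → ℕ} [∀ μ, NeZero (M μ)]

/-- KERNEL-CHECKED — (2.153) ON THE TORUS FOR THE GENUINE Δ_k with γ′₀ = `gamma2153 d L` (γ₀ = (4/π²)^{d+2} road):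
⟨B, (Re Δ_k)B⟩ ≥ γ′₀‖B‖² on {QB = 0, B(Γ_{y,x}) = 0} (`lowerOnConstrainedT_of_represents` + `represents_reDelK`).
[cite: Balaban1984PropagatorsII, (2.153) p.249; Balaban1984PropagatorsI, (1.67) p.29] -/
theorem lowerOnConstrainedT_reDelK (hd : 2 ≤ d) (hL : 1 ≤ L) (n : ℕ) (hn : 1 ≤ n) (hLM : ∀ i, L ∣ M i) :
    LowerOnConstrainedT L M (reDelK n hn M) (gamma2153 d L) :=
  lowerOnConstrainedT_of_represents M hd hL n hn hLM (represents_reDelK n hn M)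

/-- KERNEL-CHECKED — C*(Re Δ_k)C IS POSITIVE DEFINITE for the genuine Δ_k (d ≥ 2, L ≥ 1, n ≥ 1, L ∣ M_i): the
reduced form of (2.155) is a bona fide Gaussian. [cite: Balaban1984PropagatorsII, (2.155)–(2.157) p.250] -/
theorem sandwich_posDef_reDelK (hd : 2 ≤ d) (hL : 1 ≤ L) (hLM : ∀ i, L ∣ M i) (n : ℕ) (hn : 1 ≤ n) :
    ((elimT L M)ᵀ * reDelK n hn M * elimT L M).PosDef :=
  sandwich_posDef hL hLM (reDelK_isSymm n hn M) (gamma2153_pos (le_trans (by norm_num) hd) hL)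
    (lowerOnConstrainedT_reDelK hd hL n hn hLM)

/-- KERNEL-CHECKED — Z′^{(k)} = √(2π)^{|B′|}/√det(C*Δ_kC) for the genuine Δ_k. [cite: Balaban1984PropagatorsII, (2.155) p.250] -/
theorem Zred_reDelK (hd : 2 ≤ d) (hL : 1 ≤ L) (hLM : ∀ i, L ∣ M i) (n : ℕ) (hn : 1 ≤ n) :
    Zred L M (reDelK n hn M) =
      Real.sqrt (2 * Real.pi) ^ (freeT L M).card / Real.sqrt ((elimT L M)ᵀ * reDelK n hn M * elimT L M).det :=
  Zred_eq (sandwich_posDef_reDelK hd hL hLM n hn)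

/-- **KERNEL-CHECKED — THE DISPLAY (2.155) FOR THE GENUINE Δ_k ON THE TORUS, EVERYTHING EVALUATED**:
(L^d)^{|Λ′|}∫dB′ e^{−½⟨CB′,Δ_kCB′⟩+⟨J,CB′⟩} = (L^d)^{|Λ′|}·√(2π)^{|B′|}/√det(C*Δ_kC)·e^{½⟨C*J,(C*Δ_kC)⁻¹C*J⟩}, no
hypothesis left (d ≥ 2, L ≥ 1, n ≥ 1, L ∣ M_i). [cite: Balaban1984PropagatorsII, (2.155) p.250] -/
theorem eq_2155_reDelK (hd : 2 ≤ d) (hL : 1 ≤ L) (hLM : ∀ i, L ∣ M i) (n : ℕ) (hn : 1 ≤ n)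
    (J : B4.Idx (pbox M) d → ℝ) :
    ((L : ℝ) ^ d) ^ (faces L M).card * redInt L M (reDelK n hn M) J =
      ((L : ℝ) ^ d) ^ (faces L M).card *
        (Real.sqrt (2 * Real.pi) ^ (freeT L M).card / Real.sqrt ((elimT L M)ᵀ * reDelK n hn M * elimT L M).det) *
        Real.exp ((1 / 2 : ℝ) * (((elimT L M)ᵀ *ᵥ J) ⬝ᵥ ((elimT L M)ᵀ * reDelK n hn M * elimT L M)⁻¹ *ᵥ
          ((elimT L M)ᵀ *ᵥ J))) :=
  eq_2155_eval hL hLM (reDelK_isSymm n hn M) (gamma2153_pos (le_trans (by norm_num) hd) hL)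
    (lowerOnConstrainedT_reDelK hd hL n hn hLM) J

end Consequences

/-! ## §4  (2.153) and (2.157) with the β cell's γ₀ = 1 for the genuine operator; the typed node `B6.LowerBound2153` -/

section Sharp

variable {L : ℕ} (M : Fin d → ℕ) [∀ μ, NeZero (M μ)]

/-- The constant (γ₀/12d²)L^{−d−1} of (2.153)/(2.157) with the β cell's γ₀ = 1 (`Beta.Ineq167OperatorUpper.ineq167_DelK`).
[cite: Balaban1984PropagatorsII, (2.153) p.249, (2.157) p.250 (γ₀ ours)] -/
def gamma2153one (d L : ℕ) : ℝ := 1 / (12 * (d : ℝ) ^ 2) * (L : ℝ) ^ (-((d : ℝ) + 1))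

omit [∀ μ, NeZero (M μ)] in
/-- (1/12d²)L^{−d−1} > 0 (d ≥ 1, L ≥ 1). [folklore] -/
theorem gamma2153one_pos (hd : 1 ≤ d) (hL : 1 ≤ L) : 0 < gamma2153one d L := by
  unfold gamma2153one
  have h1 : (0 : ℝ) < d := by exact_mod_cast hd
  have h2 : (0 : ℝ) < L := by exact_mod_cast hL
  positivity

omit [∀ μ, NeZero (M μ)] in
/-- `gamma2153 d L = (4/π²)^{d+2} · gamma2153one d L`. [folklore] -/
theorem gamma2153_eq (d L : ℕ) : gamma2153 d L = (4 / Real.pi ^ 2) ^ (d + 2) * gamma2153one d L := by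
  unfold gamma2153 gamma2153one
  ring

omit [∀ μ, NeZero (M μ)] in
/-- The γ₀ = 1 constant dominates the (4/π²)^{d+2} one: `gamma2153 d L ≤ gamma2153one d L` ((4/π²)^{d+2} ≤ 1).
[folklore] -/
theorem gamma2153_le_gamma2153one (d L : ℕ) : gamma2153 d L ≤ gamma2153one d L := by
  rw [gamma2153_eq]
  have hγ : (4 / Real.pi ^ 2) ^ (d + 2) ≤ 1 := by
    refine pow_le_one₀ (by positivity) ?_
    rw [div_le_one (by positivity)]
    have hπ : (3 : ℝ) < Real.pi := Real.pi_gt_three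
    nlinarith
  have h0 : 0 ≤ gamma2153one d L := by
    unfold gamma2153one
    positivity
  calc (4 / Real.pi ^ 2) ^ (d + 2) * gamma2153one d L ≤ 1 * gamma2153one d L :=
        mul_le_mul_of_nonneg_right hγ h0
    _ = gamma2153one d L := one_mul _

variable {M} in
/-- (2.153)_T is monotone in its constant: a lower bound with γ gives one with every γ′ ≤ γ. [folklore] -/
theorem lowerOnConstrainedT_mono {Δ : Matrix (B4.Idx (pbox M) d) (B4.Idx (pbox M) d) ℝ} {γ γ' : ℝ} (hle : γ' ≤ γ)
    (h : LowerOnConstrainedT L M Δ γ) : LowerOnConstrainedT L M Δ γ' := fun B hQ hT =>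
  (mul_le_mul_of_nonneg_right hle (Finset.sum_nonneg fun p _ => sq_nonneg (B p))).trans (h B hQ hT)

/-- **(2.153) ON THE WHOLE LATTICE T^{(k)} WITH γ₀ = 1**, concrete form: for every real vector field B on `Tor M`
with the tree gauge (2.121) on every block and (Q₁B)(c) = 0 at every coarse bond (on the periodic extension
`lift M B`), (1/12d²)L^{−d−1}‖B‖² ≤ `formDk n M B̃` (= ⟨B, Δ_kB⟩ of (1.65) by `formDelK_eq_formDk`): (2.128) on T
(`B6Lemma24Torus.lemma24_torus`) with the Q₁-term killed, then (2.118) with the β cell's γ₀ = 1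
(`B5Hk163Form166.ineq167_formDk_sharp`).
[cite: Balaban1984PropagatorsII, (2.153) p.249, (2.128) p.245, (2.118) p.243; Balaban1984PropagatorsI, (1.67) p.29] -/
theorem lowerBound2153_lattice_sharp (hd : 2 ≤ d) (hL : 1 ≤ L) (n : ℕ) (hn : 1 ≤ n) (hLM : ∀ i, L ∣ M i)
    (B : Tor M × Fin d → ℝ)
    (hT : ∀ y ∈ coarseSites L M, ∀ b ∈ treeBonds L y, lift M B b = 0)
    (hQ : ∀ c ∈ faces L M, q1 L (lift M B) c = 0) :
    gamma2153one d L * ∑ t : Tor M, ∑ ν, B (t, ν) ^ 2 ≤ formDk n M (ofRealCfg M B) := by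
  haveI : NeZero n := ⟨by omega⟩
  have h24 := lemma24_torus hd hL (pos_of_neZero M) hLM (lift M B) (isPeriodic_lift M B) hT
  have hq : q1SqT L M (lift M B) = 0 := sum_eq_zero fun c hc => by rw [hQ c hc]; ring
  rw [hq, mul_zero, zero_add, d1SqT_lift, normSqT_lift] at h24
  unfold gamma2153one
  exact h24.trans (ineq167_formDk_sharp n hn M (ofRealCfg M B)).1

/-- KERNEL-CHECKED: THE BOX CONSTRAINTS ARE THE TORUS CONSTRAINTS — for a real field B on the variables of the box with
(Q₁B^per)(c) = 0 at every face of the torus and B = 0 on the tree bonds of every block, the field `ofBox M B` on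
`Tor M × Fin d` has (2.121) on every block and (Q₁·)(c) = 0 at every coarse bond for its periodic extension
(the translation inside `B6Cov2156Torus.lowerOnConstrainedT_of_represents`, isolated). [folklore] -/
theorem constraints_ofBox (hL : 0 < L) (hLM : ∀ i, L ∣ M i) {B : B4.Idx (pbox M) d → ℝ}
    (hQ : ∀ c ∈ faces L M, q1 L (perExt M B) c = 0) (hT : ∀ p, IsTree L (coarseSites L M) p → B p = 0) :
    (∀ y ∈ coarseSites L M, ∀ b ∈ treeBonds L y, lift M (ofBox M B) b = 0) ∧
      ∀ c ∈ faces L M, q1 L (lift M (ofBox M B)) c = 0 := by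
  refine ⟨fun y hy b hb => ?_, fun c hc => by rw [lift_ofBox]; exact hQ c hc⟩
  rw [lift_ofBox]
  have hb1 : b.1 ∈ pbox M := block_subset_pbox hLM hy (mem_treeBonds.1 hb).1
  have e : perExt M B b = B (⟨b.1, hb1⟩, b.2) := by
    unfold perExt
    have h : (⟨wrap M b.1, wrap_mem_pbox (pos_of_neZero M) b.1⟩ : ↥(pbox M)) = ⟨b.1, hb1⟩ :=
      Subtype.ext (wrap_eq_self hb1)
    rw [h]
  rw [e]
  refine hT _ ((isTree_iff hL coarseSites_dvd _).2 ⟨y, hy, ?_⟩)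
  exact hb

variable {M} in
/-- **(2.153) ON THE TORUS WITH γ₀ = 1 for every Δ representing the (1.66) form** (hypothesis shape
`B6Cov2156Torus.LowerOnConstrainedT`, constant `gamma2153one d L` = (1/12d²)L^{−d−1}).
[cite: Balaban1984PropagatorsII, (2.153) p.249; Balaban1984PropagatorsI, (1.67) p.29 (γ₀ = 1 ours)] -/
theorem lowerOnConstrainedT_sharp_of_represents (hd : 2 ≤ d) (hL : 1 ≤ L) (n : ℕ) (hn : 1 ≤ n)
    (hLM : ∀ i, L ∣ M i) {Δ : Matrix (B4.Idx (pbox M) d) (B4.Idx (pbox M) d) ℝ} (hΔ : Represents M n Δ) :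
    LowerOnConstrainedT L M Δ (gamma2153one d L) := by
  intro B hQ hT
  rw [hΔ B]
  obtain ⟨hT', hQ'⟩ := constraints_ofBox M hL hLM hQ hT
  have key := lowerBound2153_lattice_sharp M hd hL n hn hLM (ofBox M B) hT' hQ'
  have hs : ∑ t : Tor M, ∑ ν, ofBox M B (t, ν) ^ 2 = ∑ p : B4.Idx (pbox M) d, B p ^ 2 := by
    rw [sum_box_eq M (fun p => B p ^ 2)]
    rfl
  rw [← hs]
  exact key

variable {M} in
/-- **KERNEL-CHECKED — (2.153) ON THE TORUS FOR THE GENUINE Δ_k WITH γ₀ = 1**: ⟨B, (Re Δ_k)B⟩ ≥ (1/12d²)L^{−d−1}‖B‖²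
on {QB = 0, B(Γ_{y,x}) = 0 for x ∈ B(y)} — d ≥ 2, L ≥ 1, n ≥ 1, L ∣ M_i; strictly stronger than
`lowerOnConstrainedT_reDelK` (`gamma2153_le_gamma2153one`).
[cite: Balaban1984PropagatorsII, (2.153) p.249; Balaban1984PropagatorsI, (1.65), (1.67) p.29 (γ₀ = 1 ours)] -/
theorem lowerOnConstrainedT_reDelK_sharp (hd : 2 ≤ d) (hL : 1 ≤ L) (n : ℕ) (hn : 1 ≤ n) (hLM : ∀ i, L ∣ M i) :
    LowerOnConstrainedT L M (reDelK n hn M) (gamma2153one d L) :=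
  lowerOnConstrainedT_sharp_of_represents hd hL n hn hLM (represents_reDelK n hn M)

variable {M} in
/-- **KERNEL-CHECKED — (2.157) WITH γ′₀ = (1/12d²)L^{−d−1} FOR THE GENUINE Δ_k on the torus**, both printed
inequalities: ⟨B′, C*Δ_kCB′⟩ ≥ γ′₀‖CB′‖² ≥ γ′₀‖B′‖² (‖CB′‖ ≥ ‖B′‖ = `elimT_iso`); d ≥ 2, L ≥ 1, n ≥ 1, L ∣ M_i.
[cite: Balaban1984PropagatorsII, (2.157) p.250 (γ₀ = 1 ours)] -/
theorem ineq_2157_reDelK_sharp (hd : 2 ≤ d) (hL : 1 ≤ L) (hLM : ∀ i, L ∣ M i) (n : ℕ) (hn : 1 ≤ n)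
    (w : freeT L M → ℝ) :
    gamma2153one d L * ∑ p, (elimT L M *ᵥ w) p ^ 2 ≤ w ⬝ᵥ ((elimT L M)ᵀ * reDelK n hn M * elimT L M) *ᵥ w ∧
      gamma2153one d L * ∑ f, w f ^ 2 ≤ gamma2153one d L * ∑ p, (elimT L M *ᵥ w) p ^ 2 :=
  ⟨ineq_2157_mid hL hLM (lowerOnConstrainedT_reDelK_sharp hd hL n hn hLM) w,
    mul_le_mul_of_nonneg_left (elimT_iso w) (gamma2153one_pos (le_trans (by norm_num) hd) hL).le⟩

end Sharp

section Node

variable {L : ℕ}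

/-- **THE TYPED NODE `B6.LowerBound2153` FOR THE GENUINE (1.65) FORM WITH γ₀ = 1** — for every d ≥ 2, L ≥ 1, every
family of steps n_i ≥ 1 and tori M_i (L ∣ M_i μ), and any constraint `QZero` killing the Q₁-term:
`B6.LowerBound2153 d L 1 (torus carriers) (⟨B, Δ_kB⟩ of (1.65)) QZero`, i.e. (2.153) «⟨B, Δ_kB⟩ ≥ (γ₀/12d²)L^{−d−1}‖B‖²»
with the β cell's (2.118) = (1.67) `ineq167_DelK` (γ₀ = 1) as `h2118` and Lemma 2.4 on the torus
(`B6LowerBound2153Torus.lemma24Printed_tor`) — exactly `B6.lowerBound2153_of_lemma24`.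
[cite: Balaban1984PropagatorsII, (2.153) p.249, (2.118) p.243, Lemma 2.4 (2.128) p.245; Balaban1984PropagatorsI, (1.65), (1.67) p.29] -/
theorem lowerBound2153_tor_DelK {I : Type} (hd : 2 ≤ d) (hL : 1 ≤ L) (n : I → ℕ) (hn : ∀ i, 1 ≤ n i)
    (M : I → Fin d → ℕ) [∀ i μ, NeZero (M i μ)] (hLM : ∀ i μ, L ∣ M i μ)
    (QZero : ∀ i, (Tor (M i) × Fin d → ℝ) → Prop)
    (hQ : ∀ i B, QZero i B → q1SqT L (M i) (lift (M i) B) = 0) :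
    LowerBound2153 d (L : ℝ) 1 (fun i => torCarrier L (M i)) (fun i B => formDelK (n i) (hn i) (M i) B) QZero :=
  lowerBound2153_of_lemma24 d (L : ℝ) 1 zero_le_one (fun i => torCarrier L (M i))
    (fun i B => formDelK (n i) (hn i) (M i) B) QZero (lemma24Printed_tor hd hL M hLM) hQ fun i B => by
      haveI : NeZero (n i) := ⟨by have := hn i; omega⟩
      rw [one_mul, formDelK_eq (n i) (hn i) (M i) 1 one_pos]
      exact (ineq167_DelK (n i) (hn i) (M i) 1 one_pos (ofRealCfg (M i) B)).1

/-- The node with «QB = 0» read verbatim: (Q₁(lift B))(c) = 0 at every coarse bond c of T, Q₁ from (2.125).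
[cite: Balaban1984PropagatorsII, (2.153) p.249, (2.125) p.245] -/
theorem lowerBound2153_tor_DelK_faces {I : Type} (hd : 2 ≤ d) (hL : 1 ≤ L) (n : I → ℕ) (hn : ∀ i, 1 ≤ n i)
    (M : I → Fin d → ℕ) [∀ i μ, NeZero (M i μ)] (hLM : ∀ i μ, L ∣ M i μ) :
    LowerBound2153 d (L : ℝ) 1 (fun i => torCarrier L (M i)) (fun i B => formDelK (n i) (hn i) (M i) B)
      (fun i B => ∀ c ∈ faces L (M i), q1 L (lift (M i) B) c = 0) :=
  lowerBound2153_tor_DelK hd hL n hn M hLM _ fun i B hB =>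
    sum_eq_zero fun c hc => by rw [hB c hc]; ring

/-- The same node in the β cell's own carrier language: `formΔk` = `(formOfDelK n hn M a ha).formΔk ∘ ofRealCfg` for any
dummies a_i > 0. [cite: Balaban1984PropagatorsII, (2.153) p.249; Balaban1984PropagatorsI, (1.65) p.29] -/
theorem lowerBound2153_tor_formOfDelK {I : Type} (hd : 2 ≤ d) (hL : 1 ≤ L) (n : I → ℕ) (hn : ∀ i, 1 ≤ n i)
    (M : I → Fin d → ℕ) [∀ i μ, NeZero (M i μ)] (hLM : ∀ i μ, L ∣ M i μ) (a : I → ℝ) (ha : ∀ i, 0 < a i)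
    (QZero : ∀ i, (Tor (M i) × Fin d → ℝ) → Prop)
    (hQ : ∀ i B, QZero i B → q1SqT L (M i) (lift (M i) B) = 0) :
    LowerBound2153 d (L : ℝ) 1 (fun i => torCarrier L (M i))
      (fun i B => (formOfDelK (n i) (hn i) (M i) (a i) (ha i)).formΔk (ofRealCfg (M i) B)) QZero := by
  intro i B hTG hQ0
  haveI : NeZero (n i) := ⟨by have := hn i; omega⟩
  exact (lowerBound2153_tor_DelK hd hL n hn M hLM QZero hQ i B hTG hQ0).trans_eq
    (formDelK_eq_formOfDelK (n i) (hn i) (M i) (a i) (ha i) B)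

end Node

/-! ## §5  (v1.1) `Δ_k` is real: the junction holds for the full complex kernel -/

section Real

variable (n : ℕ) [NeZero n] (hn : 1 ≤ n) (M : Fin d → ℕ) [∀ μ, NeZero (M μ)] (a : ℝ) (ha : 0 < a)

/-- KERNEL-CHECKED: **THE GENUINE (1.65) OPERATOR HAS REAL ENTRIES** (`B5RealFields.IsReal`: conj Δ_k(s, s′) =
Δ_k(s, s′)): Δ_k = (QGQ*)⁻¹ − a·1 (`Beta.BlockEffectiveAction.DelK_eq`), QGQ* = Q·G·Q* (`Beta.FluctuationProjection.QGQ`)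
with G = Δ_a⁻¹ (`B5DeltaA169.calG_eq_DeltaA_inv`) and Q, Q*, Δ_a⁻¹ real (pv15's `B5RealFields.isReal_QvOp`,
`isReal_QvAdj`, `isReal_DeltaA_inv`), closed under products, inverse, real scalars and differences. B5 p.18 works with
real fields «A : {b ⊂ T_ε} → ℝ» (quoted in `B5RealFields`). [folklore] -/
theorem isReal_DelK : IsReal (DelK n hn M a ha) := by
  rw [DelK_eq]
  have hQ : IsReal (QGQ n hn M a ha) := by
    unfold QGQ
    rw [calG_eq_DeltaA_inv]
    exact ((isReal_QvOp n M).mul (isReal_DeltaA_inv n M a)).mul (isReal_QvAdj n M)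
  exact hQ.inv.sub (IsReal.smul (Complex.conj_ofReal a) IsReal.one)

/-- `Im Δ_k(s, s′) = 0`. [folklore] -/
theorem im_DelK_eq_zero (s s' : Tor M × Fin d) : (DelK n hn M a ha s s').im = 0 :=
  (isReal_DelK n hn M a ha).im_eq_zero s s'

/-- `Δ_k(s, s′) = (Re Δ_k(s, s′) : ℂ)`. [folklore] -/
theorem DelK_eq_ofReal_re (s s' : Tor M × Fin d) : DelK n hn M a ha s s' = ((DelK n hn M a ha s s').re : ℂ) :=
  Complex.ext (by rw [Complex.ofReal_re]) (by rw [Complex.ofReal_im, im_DelK_eq_zero n hn M a ha])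

/-- `Δ_kᵀ = Δ_k`: the genuine operator is real symmetric (real + Hermitian). [folklore] -/
theorem DelK_transpose : (DelK n hn M a ha)ᵀ = DelK n hn M a ha :=
  (isReal_DelK n hn M a ha).transpose_eq_of_isHermitian (DelK_conjTranspose n hn M a ha)

/-- `reDelK` read in ℂ IS Δ_k in the bond basis: `(Re Δ_k)(b, b′) = Δ_k(idxEquiv b, idxEquiv b′)`. [folklore] -/
theorem reDelK_map_ofReal :
    (reDelK n hn M).map ((↑) : ℝ → ℂ) = (DelK n hn M a ha).submatrix (idxEquiv M) (idxEquiv M) := by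
  ext p q
  rw [Matrix.map_apply, Matrix.submatrix_apply, reDelK_apply n hn M a ha, ← DelK_eq_ofReal_re]

/-- **THE FULL JUNCTION, ENTRYWISE AS COMPLEX NUMBERS: `(deltaPol M n (b, b′) : ℂ) = Δ_k(b, b′)`** for every dummy
`a > 0` — THE matrix of the (1.66) form of the pv09 torus line IS the genuine (1.65) operator of the β cell in the bond
basis (v1's `deltaPol_apply_eq` + `Im Δ_k = 0`); `B6Cov2156Torus` HONEST SCOPE (ii) ∕ `B6LowerBound2153Torus` HONEST
SCOPE (i) closed with no proviso. [cite: Balaban1984PropagatorsI, (1.65)–(1.66) p.29] -/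
theorem deltaPol_eq_DelK (p q : B4.Idx (pbox M) d) :
    ((deltaPol M n p q : ℝ) : ℂ) = DelK n hn M a ha (idxEquiv M p) (idxEquiv M q) := by
  rw [deltaPol_apply_eq n hn M a ha, ← DelK_eq_ofReal_re]

/-- … as matrices: **Δ_k = `deltaPol M n` re-indexed by `idxEquiv` and read in ℂ**.
[cite: Balaban1984PropagatorsI, (1.65)–(1.66) p.29] -/
theorem DelK_eq_reindex_deltaPol :
    DelK n hn M a ha = ((deltaPol M n).reindex (idxEquiv M) (idxEquiv M)).map ((↑) : ℝ → ℂ) := by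
  ext s s'
  rw [Matrix.map_apply, Matrix.reindex_apply, Matrix.submatrix_apply, deltaPol_eq_DelK n hn M a ha,
    Equiv.apply_symm_apply, Equiv.apply_symm_apply]

/-- … and the (2.152) quadratic form of a real field is literally the deltaPol form, for COMPLEX-valued test vectors
too: `Xᴴ·Δ_k·X = Xᴴ·(deltaPol read in ℂ, re-indexed)·X`. [folklore] -/
theorem form_DelK_eq_form_deltaPol (X : Tor M × Fin d → ℂ) :
    star X ⬝ᵥ (DelK n hn M a ha *ᵥ X)
      = star X ⬝ᵥ ((((deltaPol M n).reindex (idxEquiv M) (idxEquiv M)).map ((↑) : ℝ → ℂ)) *ᵥ X) := by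
  rw [← DelK_eq_reindex_deltaPol n hn M a ha]

end Real

end Literature.MathematicalPhysics.QuantumFieldTheory.Balaban1983to89.B6Cov2156TorusDelK

end
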